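import Summits.AtomisticToContinuum.BoseEinsteinCondensation.Theses.BECVortexSheetPeierls
import Summits.AtomisticToContinuum.BoseEinsteinCondensation.Theorems.BECPeriodicReductionBoundaryTransferWeakResidual

/-!
# RE-AUDIT SUPPLEMENT (instance vortexsheet) — Lean companion — crux `BECVortexSheetPeierls.BoundaryTransferWeak` (stmt-AtomisticToContinuum-0827)

crux-strategist re-audit seat `planner-cstrat-stmt-AtomisticToContinuum-0827-r1-0`, 2026-08-17.
Kernel-checked content referred to by `Cruxes/BoundaryTransferWeak/REAUDIT-RECONCILIATION-vortexsheet.md` (lean check rc 0, 0 sorries):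

* §0 frame: the crux is the SHARED item (same signature as `BECPeriodicReduction.BoundaryTransferWeak`),
  a strict consequence of the conjunct (`crux_of_statement`), and already reduced to the reward-free
  residual by the landed p96138 (`crux_of_condensedToBEC`).
* §1 candidate split R (reward seam): `TorusToRewardedBound ∧ CondensedToBEC → crux`
  (`crux_of_rewardSplit`, the assembly quoted in the census), with `torusToRewardedBound_holds`
  (piece 1 is ALREADY a theorem, `RewardPaysTheWall.stub_transfer`) and `condensedToBEC_of_statement`
  (piece 2 is a consequence of the conjunct by weakening — the RESTATED pattern one level down).
* §2 candidate split Q (reward/penalty sandwich): the pieces `DiffAtZeroReward`, `ChordRetention` typed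
  (assembly on paper in the census; not filed — see census §Q for why the open piece is flat-mode
  ground-state BEC in chord-slope clothing below the gap scale).
* §3 candidate split M (rim squeeze, crux idea `rim-squeeze-monotone-coherence` of ideator k2, round 1,
  2026-08-17): the ideator's definitions and three children copied VERBATIM (attribution: 
  `Cruxes/BoundaryTransferWeak/RimSqueezeSketch.lean`) and the glue re-targeted to THIS route's decl
  (`crux_of_rimSqueeze`) — the prepared redirect, gated on triage of the idea.
-/

noncomputable section

namespace Summit.AtomisticToContinuum.BoseEinsteinCondensation.Cruxes.BoundaryTransferWeak.StrategyCensus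

open Literature.MathematicalPhysics.QuantumManyBody.BoseGas
open Summit.AtomisticToContinuum.BoseEinsteinCondensation.RewardPaysTheWall
open MeasureTheory Filter Set
open scoped ENNReal NNReal Topology

/-! ## §0 Frame -/

/-- The crux under audit, by name. -/
abbrev Crux : Prop := Theses.BECVortexSheetPeierls.BoundaryTransferWeak

/-- It is the shared item stmt-0827: syntactically the decl of the retired home route. -/
theorem crux_iff_periodicReduction :
    Crux ↔ Theses.BECPeriodicReduction.BoundaryTransferWeak := Iff.rfl

/-- `S → crux` by weakening (the crux's conclusion is the conjunct's body): the crux is a CONSEQUENCE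
of the sub-problem statement (bc2 verdict "weaker"), not a restatement. -/
theorem crux_of_statement (hS : _root_.BoseEinsteinCondensation) : Crux :=
  fun v hv _ => hS v hv

/-- The landed partial structure (p96138): the crux follows from the reward-free residual
"condensed Dirichlet competitors suffice" for every admissible `v`. -/
theorem crux_of_condensedToBEC
    (h : ∀ v : ℝ → ℝ≥0∞, IsRepulsiveFiniteRange v → ∃ ρ₄ : ℝ, 0 < ρ₄ ∧ ∀ ρ : ℝ, 0 < ρ → ρ < ρ₄ →
      ∀ c : ℝ, 0 < c → c ≤ 1 →
        (∀ θ : ℝ, 0 < θ → ∀ᶠ N : ℕ in atTop, ∃ Ψ : TrialState N (sideLength ρ N),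
          energy v Ψ ≤ groundStateEnergy v N (sideLength ρ N) + ENNReal.ofReal (θ * N) ∧
            ENNReal.ofReal ((c - θ) * N) ≤ occupation N (boxConstantMode (sideLength ρ N)) Ψ.ψ) →
        HasGroundStateBEC v ρ) : Crux :=
  boundaryTransferWeak_of_condensedToBEC h

/-! ## §1 Candidate R — the reward seam (proved transfer ∧ open residual) -/

/-- Piece R1 (what crosses the wall; PROVED in tree as `stub_transfer`, p85115 over p74246–p76612):
torus BEC at `(v, ρ, c)` gives the rewarded upper bound in the Dirichlet box with constant `min c 1`. -/
def TorusToRewardedBound : Prop :=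
  ∀ v : ℝ → ℝ≥0∞, IsRepulsiveFiniteRange v → ∃ ρ₁ : ℝ, 0 < ρ₁ ∧ ∀ ρ : ℝ, 0 < ρ → ρ < ρ₁ →
    ∀ c : ℝ, 0 < c → TorusBECAt v ρ c → RewardedUpperBound v ρ (min c 1)

/-- Piece R2 (the reward-free residual, OPEN for `v ≠ 0`): flat-condensed Dirichlet competitors within
`θN` of `E₀^D` for every `θ > 0` imply ground-state BEC, at all small densities. -/
def CondensedToBEC : Prop :=
  ∀ v : ℝ → ℝ≥0∞, IsRepulsiveFiniteRange v → ∃ ρ₄ : ℝ, 0 < ρ₄ ∧ ∀ ρ : ℝ, 0 < ρ → ρ < ρ₄ →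
    ∀ c : ℝ, 0 < c → c ≤ 1 →
      (∀ θ : ℝ, 0 < θ → ∀ᶠ N : ℕ in atTop, ∃ Ψ : TrialState N (sideLength ρ N),
        energy v Ψ ≤ groundStateEnergy v N (sideLength ρ N) + ENNReal.ofReal (θ * N) ∧
          ENNReal.ofReal ((c - θ) * N) ≤ occupation N (boxConstantMode (sideLength ρ N)) Ψ.ψ) →
      HasGroundStateBEC v ρ

/-- R1 is already a theorem of the tree. -/
theorem torusToRewardedBound_holds : TorusToRewardedBound := stub_transfer

/-- R2 is a consequence of the conjunct by weakening (its conclusion is the conjunct's body): the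
RESTATED pattern reappears one level down. -/
theorem condensedToBEC_of_statement (hS : _root_.BoseEinsteinCondensation) : CondensedToBEC := by
  intro v hv
  obtain ⟨ρ₀, hρ₀, H⟩ := hS v hv
  exact ⟨ρ₀, hρ₀, fun ρ hρ hlt _ _ _ _ => H ρ hρ hlt⟩

/-- **Assembly of candidate R** (quoted in the census): R1 ∧ R2 → crux. Sixteen lines: four density
thresholds, the density cap of `exists_density_cap_tendsto_e0` (E₀^D(N,L_N)/N → e₀ < ∞), and the landed
Griffiths sandwich `eventually_exists_condensed_of_rewardedUpperBound` (rewarded bound ⟹ condensed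
competitors). Logical skeleton: a chain `A → Q → B` through the new middle object `Q` = rewarded upper
bound / condensed competitors. -/
theorem crux_of_rewardSplit (h₁ : TorusToRewardedBound) (h₂ : CondensedToBEC) : Crux := by
  intro v hv hA
  obtain ⟨ρA, hρA, HA⟩ := hA
  obtain ⟨ρ₁, hρ₁, H1⟩ := h₁ v hv
  obtain ⟨ρ₂, hρ₂, H2⟩ := exists_density_cap_tendsto_e0 v hv
  obtain ⟨ρ₄, hρ₄, H4⟩ := h₂ v hv
  refine ⟨min (min ρA ρ₁) (min ρ₂ ρ₄), lt_min (lt_min hρA hρ₁) (lt_min hρ₂ hρ₄),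
    fun ρ hρ hlt => ?_⟩
  obtain ⟨c, hc, hT⟩ := HA ρ hρ (hlt.trans_le ((min_le_left _ _).trans (min_le_left _ _)))
  obtain ⟨he, hTD, -⟩ := H2 ρ hρ (hlt.trans_le ((min_le_right _ _).trans (min_le_left _ _)))
  have hU : RewardedUpperBound v ρ (min c 1) :=
    H1 ρ hρ (hlt.trans_le ((min_le_left _ _).trans (min_le_right _ _))) c hc hT
  exact H4 ρ hρ (hlt.trans_le ((min_le_right _ _).trans (min_le_right _ _))) (min c 1)
    (lt_min hc one_pos) (min_le_right c 1)
    (fun θ hθ => eventually_exists_condensed_of_rewardedUpperBound he hTD (lt_min hc one_pos)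
      (min_le_right c 1) hU hθ)

/-- What remains of the crux after R1: the crux from R2 alone (R1 discharged by the tree). -/
theorem crux_of_condensedToBEC' (h₂ : CondensedToBEC) : Crux :=
  crux_of_rewardSplit torusToRewardedBound_holds h₂

/-! ## §2 Candidate Q — reward/penalty sandwich at finite `N`

`F_N(μ) = rewardedInf v μ N L` (infimum of `⟨H⟩ + μ(N − n_φ)`, flat mode `φ`), `G_N(μ) = penalisedInf`
(infimum of `⟨H⟩ + μ n_φ`), `E₀ = F_N(0) = G_N(0)`. On paper: for a `δ`-near-minimiser `Ψ₀`,
`μ n_φ(Ψ₀) ≥ G_N(μ) − E₀ − δ`; `DiffAtZeroReward` converts reward-side into penalty-side information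
AT FIXED `N` (`G_N(μ) + F_N(μ) ≥ 2E₀ + (1−ε)μN` for `μ < μ₀(N)`: Kato differentiability of the
rewarded ground-state energy at `μ = 0` for a non-degenerate ground state); `ChordRetention` keeps a
fraction `κ` of the rewarded condensate down to `μ → 0⁺` UNIFORMLY in `N`; the transfer R1 supplies the
slope at `λ₀`. Assembly: `n_φ(Ψ₀) ≥ N(κ(c λ₀ − 2θ)/λ₀ − ε)·… − δ/μ`. Not filed: `μ₀(N) ≍ L_N⁻²`
(phase-twisted ground states), so `ChordRetention` is needed at sub-gap `μ`, where the chord slope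
`(F_N(μ) − E₀)/μ` IS `N − n_φ(Ψ₀)` to first order — flat-mode ground-state BEC (stmt-0686) in costume. -/

/-- The penalised infimum `G_N(μ) = inf_Ψ ⟨Ψ,HΨ⟩ + μ n_φ(Ψ)`. -/
def penalisedInf (v : ℝ → ℝ≥0∞) (μ : ℝ) (N : ℕ) (L : ℝ) : ℝ≥0∞ :=
  ⨅ Ψ : TrialState N L, energy v Ψ + ENNReal.ofReal μ * occupation N (boxConstantMode L) Ψ.ψ

/-- Piece Q1 — differentiability of the rewarded ground-state energy at zero reward, per `N`
(finite-difference form, no derivatives): rewarded + penalised infima are jointly affine to first order. -/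
def DiffAtZeroReward : Prop :=
  ∀ v : ℝ → ℝ≥0∞, IsRepulsiveFiniteRange v → ∃ ρ₀ : ℝ, 0 < ρ₀ ∧ ∀ ρ : ℝ, 0 < ρ → ρ < ρ₀ →
    ∀ᶠ N : ℕ in atTop, ∀ ε : ℝ, 0 < ε → ∃ μ₀ : ℝ, 0 < μ₀ ∧ ∀ μ : ℝ, 0 < μ → μ < μ₀ →
      2 * groundStateEnergy v N (sideLength ρ N) + ENNReal.ofReal ((1 - ε) * μ * N) ≤
        penalisedInf v μ N (sideLength ρ N) + rewardedInf v μ N (sideLength ρ N)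

/-- Piece Q2 — chord retention: the condensate read off the chord of `F_N` from `0` to `μ` retains a
fraction `κ` of the condensate read off the chord to `λ₀`, uniformly in `N` down to `μ → 0⁺`
(additive `ℝ≥0∞` form of `κ μ (λ₀N − (F(λ₀)−E₀)) ≤ λ₀ (μN − (F(μ)−E₀))`). -/
def ChordRetention : Prop :=
  ∀ v : ℝ → ℝ≥0∞, IsRepulsiveFiniteRange v → ∃ ρ₀ : ℝ, 0 < ρ₀ ∧ ∀ ρ : ℝ, 0 < ρ → ρ < ρ₀ →
    ∃ κ : ℝ, 0 < κ ∧ ∃ lam₀ : ℝ, 0 < lam₀ ∧ ∀ᶠ N : ℕ in atTop, ∀ μ : ℝ, 0 < μ → μ < lam₀ →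
      ENNReal.ofReal (κ * μ) * (ENNReal.ofReal (lam₀ * N) -
          (rewardedInf v lam₀ N (sideLength ρ N) - groundStateEnergy v N (sideLength ρ N))) ≤
        ENNReal.ofReal lam₀ * (ENNReal.ofReal (μ * N) -
          (rewardedInf v μ N (sideLength ρ N) - groundStateEnergy v N (sideLength ρ N)))

/-! ## §3 Candidate M — rim squeeze (ideator k2's children, glue re-targeted to this route)

Definitions and the three children are copied verbatim from
`Cruxes/BoundaryTransferWeak/RimSqueezeSketch.lean` (planner-cruxidea-stmt-AtomisticToContinuum-0827-2-0,
2026-08-17) so that this file is self-contained; only `crux_of_rimSqueeze` (target decl) is new. -/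

/-- Rim potential: `1` on `{x : ∃ k, L'/2 ≤ x_k}`, `0` elsewhere. -/
def rimPot (L' : ℝ) : Space → ℝ≥0∞ :=
  {x : Space | ∃ k, L' / 2 ≤ x k}.indicator fun _ => 1

/-- Normalised indicator of the core cube `(L'/8, 3L'/8)³`. -/
def coreMode (L' : ℝ) : Space → ℂ :=
  {x : Space | ∀ k, x k ∈ Ioo (L' / 8) (3 * L' / 8)}.indicator fun _ => ((Real.sqrt ((L' / 4) ^ 3))⁻¹ : ℂ)

/-- Rim term of the ramp Hamiltonian. -/
def rimEnergy {N : ℕ} {L' : ℝ} (w : Space → ℝ≥0∞) (t : ℝ≥0∞) (Ψ : PeriodicTrialState N L') : ℝ≥0∞ :=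
  t * ∫⁻ X in cellN N L', (∑ j, w (X j)) * (‖Ψ.ψ X‖₊ : ℝ≥0∞) ^ 2

/-- Quadratic form of `H_t = H^per + t Σ_j w(x_j)`. -/
def rampEnergy {N : ℕ} {L' : ℝ} (v : ℝ → ℝ≥0∞) (w : Space → ℝ≥0∞) (t : ℝ≥0∞)
    (Ψ : PeriodicTrialState N L') : ℝ≥0∞ :=
  periodicEnergy v Ψ + rimEnergy w t Ψ

/-- Ground-state energy of `H_t`. -/
def rampGroundStateEnergy (v : ℝ → ℝ≥0∞) (w : Space → ℝ≥0∞) (t : ℝ≥0∞) (N : ℕ) (L' : ℝ) : ℝ≥0∞ :=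
  ⨅ Ψ : PeriodicTrialState N L', rampEnergy v w t Ψ

/-- Occupation of a cell mode in the ground state of `H_t`, through near-minimisers. -/
def rampOccupation (v : ℝ → ℝ≥0∞) (w : Space → ℝ≥0∞) (t : ℝ≥0∞) (N : ℕ) (L' : ℝ) (φ : Space → ℂ) :
    ℝ≥0∞ :=
  ⨆ (δ : ℝ≥0∞) (_ : 0 < δ), ⨅ (Ψ : PeriodicTrialState N L')
    (_ : rampEnergy v w t Ψ ≤ rampGroundStateEnergy v w t N L' + δ), cellOccupation N L' φ Ψ.ψ

/-- Core flat-mode occupation of the ground state of `H_t` on the torus of density `ρ'`. -/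
def coreOcc (v : ℝ → ℝ≥0∞) (t : ℝ≥0∞) (N : ℕ) (ρ' : ℝ) : ℝ≥0∞ :=
  rampOccupation v (rimPot (sideLength ρ' N)) t N (sideLength ρ' N) (coreMode (sideLength ρ' N))

/-- Child M1 (the bet): rim-squeeze monotonicity. -/
def RimSqueezeMonotone : Prop :=
  ∀ v : ℝ → ℝ≥0∞, IsRepulsiveFiniteRange v → ∃ ρ₁ : ℝ, 0 < ρ₁ ∧ ∀ ρ' : ℝ, 0 < ρ' → ρ' < ρ₁ →
    ∀ᶠ N : ℕ in atTop, ∀ s t : ℝ≥0∞, s ≤ t → coreOcc v s N ρ' ≤ coreOcc v t N ρ'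

/-- Child M2 (support; consumes `A`, needs torus ground-state rigidity): torus core floor. -/
def TorusCoreFloor : Prop :=
  ∀ v : ℝ → ℝ≥0∞, IsRepulsiveFiniteRange v →
    (∃ ρ₀ : ℝ, 0 < ρ₀ ∧ ∀ ρ : ℝ, 0 < ρ → ρ < ρ₀ → ∃ c : ℝ, 0 < c ∧ ∀ᶠ N : ℕ in atTop,
      ∃ δ : ℝ≥0∞, 0 < δ ∧ ∀ Ψ : PeriodicTrialState N (sideLength ρ N),
        periodicEnergy v Ψ ≤ periodicGroundStateEnergy v N (sideLength ρ N) + δ →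
          ENNReal.ofReal (c * N) ≤ condensateOccupation N (sideLength ρ N) Ψ.ψ) →
    ∃ ρ₁ : ℝ, 0 < ρ₁ ∧ ∀ ρ' : ℝ, 0 < ρ' → ρ' < ρ₁ →
      ∃ c : ℝ, 0 < c ∧ ∀ᶠ N : ℕ in atTop, ENNReal.ofReal (c * N) ≤ coreOcc v 0 N ρ'

/-- Child M3 (support, provable now): Dirichlet endpoint at density `8ρ'`. -/
def DirichletEndpoint : Prop :=
  ∀ v : ℝ → ℝ≥0∞, IsRepulsiveFiniteRange v → ∀ ρ' : ℝ, 0 < ρ' →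
    (∃ c : ℝ, 0 < c ∧ ∀ᶠ N : ℕ in atTop, ENNReal.ofReal (c * N) ≤ coreOcc v ⊤ N ρ') →
      HasGroundStateBEC v (8 * ρ')

/-- **Assembly of candidate M** re-targeted to this route's decl (ideator's proof, 17 lines): floor at
`t = 0` from `A`, transported to `t = ⊤` by monotonicity, turned into `HasGroundStateBEC v ρ` at
`ρ = 8ρ'`. -/
theorem crux_of_rimSqueeze (hM : RimSqueezeMonotone) (hT : TorusCoreFloor)
    (hD : DirichletEndpoint) : Crux := by
  intro v hv hA
  obtain ⟨ρ₁, hρ₁, hM'⟩ := hM v hv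
  obtain ⟨ρ₂, hρ₂, hT'⟩ := hT v hv hA
  refine ⟨8 * min ρ₁ ρ₂, by positivity, fun ρ hρ hρlt => ?_⟩
  have hρ' : 0 < ρ / 8 := by positivity
  have h1 : ρ / 8 < ρ₁ := by
    have := min_le_left ρ₁ ρ₂
    linarith
  have h2 : ρ / 8 < ρ₂ := by
    have := min_le_right ρ₁ ρ₂
    linarith
  obtain ⟨c, hc, hev⟩ := hT' (ρ / 8) hρ' h2
  have key : ∀ᶠ N : ℕ in atTop, ENNReal.ofReal (c * N) ≤ coreOcc v ⊤ N (ρ / 8) :=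
    (hev.and (hM' (ρ / 8) hρ' h1)).mono fun N ⟨hN, hmono⟩ => hN.trans (hmono 0 ⊤ le_top)
  have h8 : HasGroundStateBEC v (8 * (ρ / 8)) := hD v hv (ρ / 8) hρ' ⟨c, hc, key⟩
  have e : (8 : ℝ) * (ρ / 8) = ρ := by ring
  exact e ▸ h8

/-- What the assembly actually consumes of M1: ENDPOINT DOMINATION `coreOcc 0 ≤ coreOcc ⊤` (the path
is the proposed mechanism, not a logical input). Recorded for the costume check in the census. -/
def EndpointDomination : Prop :=
  ∀ v : ℝ → ℝ≥0∞, IsRepulsiveFiniteRange v → ∃ ρ₁ : ℝ, 0 < ρ₁ ∧ ∀ ρ' : ℝ, 0 < ρ' → ρ' < ρ₁ →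
    ∀ᶠ N : ℕ in atTop, coreOcc v 0 N ρ' ≤ coreOcc v ⊤ N ρ'

theorem endpointDomination_of_monotone (hM : RimSqueezeMonotone) : EndpointDomination := by
  intro v hv
  obtain ⟨ρ₁, hρ₁, H⟩ := hM v hv
  exact ⟨ρ₁, hρ₁, fun ρ' hρ' hlt => (H ρ' hρ' hlt).mono fun N hN => hN 0 ⊤ le_top⟩

theorem crux_of_endpointDomination (hE : EndpointDomination) (hT : TorusCoreFloor)
    (hD : DirichletEndpoint) : Crux := by
  intro v hv hA
  obtain ⟨ρ₁, hρ₁, hE'⟩ := hE v hv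
  obtain ⟨ρ₂, hρ₂, hT'⟩ := hT v hv hA
  refine ⟨8 * min ρ₁ ρ₂, by positivity, fun ρ hρ hρlt => ?_⟩
  have hρ' : 0 < ρ / 8 := by positivity
  have h1 : ρ / 8 < ρ₁ := by
    have := min_le_left ρ₁ ρ₂
    linarith
  have h2 : ρ / 8 < ρ₂ := by
    have := min_le_right ρ₁ ρ₂
    linarith
  obtain ⟨c, hc, hev⟩ := hT' (ρ / 8) hρ' h2
  have key : ∀ᶠ N : ℕ in atTop, ENNReal.ofReal (c * N) ≤ coreOcc v ⊤ N (ρ / 8) :=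
    (hev.and (hE' (ρ / 8) hρ' h1)).mono fun N ⟨hN, hdom⟩ => hN.trans hdom
  have h8 : HasGroundStateBEC v (8 * (ρ / 8)) := hD v hv (ρ / 8) hρ' ⟨c, hc, key⟩
  have e : (8 : ℝ) * (ρ / 8) = ρ := by ring
  exact e ▸ h8

end Summit.AtomisticToContinuum.BoseEinsteinCondensation.Cruxes.BoundaryTransferWeak.StrategyCensus

end
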